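import Literature.IUT.HodgeTheaters.TemperedCoveringsByName
import Literature.IUT.HodgeTheaters.TemperedCoveringsChartsAt
import HarnessLib

/-!
# [IUTchI] Prop. 2.1 / 2.2 from the tempered data BY NAME, with [SemiAnbd] Thm 3.7 (iii) AT THE ONE GRAPH `𝒢`

Mochizuki, *Inter-universal Teichmüller theory I*, kurims manuscript (May 2020), §2, Proposition 2.1
"Profinite Conjugates of Nontrivial Compact Subgroups" and Proposition 2.2, p. 45
[cite: Mochizuki2012, Prop 2.1 p.45] (D-0012 claim key; series status DISPUTED; nothing of the
series is asserted here).

PROOF-ONLY companion (abc-iut cell, φ2-consumers programme, L5 block «φ2-L5» item L5b, seat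
abc-iut-L3-d1) of `TemperedCoveringsByName.lean` (abc-iut-L5-t11): the SAME proofs of
`prop21_of_chart_of_isProfiniteCompletion` and `tp_isCommensurablyTerminal_of_chart_of_isProfiniteCompletion`,
with the ∀-countable named fact `ProfiniteSemiGraph.CompactInVerticial` ([SemiAnbd] Thm 3.7 (iii), F-1732)
replaced by its per-graph form `ProfiniteSemiGraph.CompactInVerticialAt 𝒢` (abc-iut-w4-d075,
`TemperedCompactInVerticialAt.lean`; the frozen fact is `∀ 𝒢, CompactInVerticialAt 𝒢` by `Iff.rfl`) at the
ONE graph `𝒢` of the chart — the dual semi-graph of a pointed stable curve is finite, the scope of print's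
proof of Thm 3.7 (iii) and of the cell's finite-`𝔾` producer.  Port rule: binder
`(hCV : CompactInVerticial)` ↦ `(hCV : CompactInVerticialAt 𝒢)`, the (A1) input through
`conj_le_of_compactInVerticial_at` (item L5a), decl suffix `_at`; everything else verbatim; the original is
untouched.  Typed ≠ proved; nothing here bears on [IUTchIII] Cor. 3.12.
-/

namespace Literature.IUT.HodgeTheaters

open Pointwise Filter
open _root_.Topology
open Literature.AnabelianGeometry.SemiGraphs (IsTempered IsProfiniteCompletion ProfiniteSemiGraph)
open Literature.AnabelianGeometry.SemiGraphs.ProfiniteSemiGraph (TemperedPiChart verticialSubgroups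
  CompactInVerticialAt VerticialInjective)
open Literature.AnabelianGeometry.AbsoluteAnabelian (IsCommensurablyTerminal)

universe u

namespace TemperedGraphGroupData

variable (D : TemperedGraphGroupData.{u}) {𝒢 : ProfiniteSemiGraph.{u}}

/-- **[IUTchI] Proposition 2.1 AS TYPED, every [SemiAnbd] input BY NAME, with Thm 3.7 (iii) AT `𝒢`**
(`CompactInVerticialAt 𝒢`): inputs the chart (Prop 3.6 (i)(ii)), `IsProfiniteCompletion` (Prop 3.6 (iii)),
Galois domination with residually finite deck groups, a verticial family (Thm 3.7 (i)); REMAINING as in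
the original: the node data of the universal pro-covering in coset coordinates and (A3).  φ2 twin of
`prop21_of_chart_of_isProfiniteCompletion`. ([IUTchI] Prop 2.1 p.45) [claim: Mochizuki2012, status: disputed] -/
theorem prop21_of_chart_of_isProfiniteCompletion_at (c : TemperedPiChart 𝒢) (e : D.Tp ≃ₜ* c.G)
    (h𝒢 : 𝒢.Thm37Hypotheses) (hCV : CompactInVerticialAt 𝒢)
    (hPC : IsProfiniteCompletion
      ({ toMonoidHom := D.ι, continuous_toFun := D.ι_continuous } : D.Tp →ₜ* D.Hat))
    (hGal : ∀ S : ProfiniteSemiGraph.BTempCat 𝒢, Literature.AlgebraicGeometry.Frobenioids.IsConnectedObj S →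
      ∃ (H : ProfiniteSemiGraph.BTempCat 𝒢) (_ : H ⟶ S),
        Literature.AnabelianGeometry.SemiGraphs.IsGaloisObj H ∧ Group.ResiduallyFinite (CategoryTheory.Aut H))
    (Λv : 𝒢.graph.Vertex → Subgroup D.Tp)
    (hΛv : ∀ v, (Λv v).map (e : D.Tp →* c.G) ∈ verticialSubgroups c v)
    {E : Type*} (src tgt : E → 𝒢.graph.Vertex) (c₁ c₂ : E → D.Tp)
    (hA3 : ∀ (v w : 𝒢.graph.Vertex) (g h : D.Hat),
      MulAut.conj g • (Λv v).map D.ι ⊓ MulAut.conj h • (Λv w).map D.ι ≠ ⊥ →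
        (v = w ∧ g⁻¹ * h ∈ (Λv v).map D.ι) ∨
        ∃ (e : E) (k : D.Hat), ∃ p ∈ (Λv (src e)).map D.ι, ∃ q ∈ (Λv (tgt e)).map D.ι,
          (src e = v ∧ tgt e = w ∧ g = k * D.ι (c₁ e) * p ∧ h = k * D.ι (c₂ e) * q) ∨
          (src e = w ∧ tgt e = v ∧ h = k * D.ι (c₁ e) * p ∧ g = k * D.ι (c₂ e) * q)) :
    D.ProfiniteConjugatesOfCompactSubgroups :=
  D.prop21_of_cosetTree_of_isProfiniteCompletion (D.isTempered_tp_of_chart c e) hPC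
    (D.exists_residuallyFinite_quotient_of_chart c e hGal) Λv src tgt c₁ c₂
    (fun Λ hΛc _ => D.conj_le_of_compactInVerticial_at c e h𝒢 hCV Λv hΛv Λ hΛc) hA3

/-- **[IUTchI] Proposition 2.2, "in particular, `Π^tp_𝔾` is commensurably terminal in `Π̂_𝔾`", every
[SemiAnbd] input BY NAME, with Thm 3.7 (iii) AT `𝒢`** (`CompactInVerticialAt 𝒢`; plus `VerticialInjective`,
Thm 3.7 (i), for the infinite compact verticial subgroup).  φ2 twin of
`tp_isCommensurablyTerminal_of_chart_of_isProfiniteCompletion`. ([IUTchI] Prop 2.2 p.45) [claim: Mochizuki2012, status: disputed] -/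
theorem tp_isCommensurablyTerminal_of_chart_of_isProfiniteCompletion_at (c : TemperedPiChart 𝒢)
    (e : D.Tp ≃ₜ* c.G) (h𝒢 : 𝒢.Thm37Hypotheses) (hCV : CompactInVerticialAt 𝒢)
    (hVI : VerticialInjective.{u})
    (hPC : IsProfiniteCompletion
      ({ toMonoidHom := D.ι, continuous_toFun := D.ι_continuous } : D.Tp →ₜ* D.Hat))
    (hGal : ∀ S : ProfiniteSemiGraph.BTempCat 𝒢, Literature.AlgebraicGeometry.Frobenioids.IsConnectedObj S →
      ∃ (H : ProfiniteSemiGraph.BTempCat 𝒢) (_ : H ⟶ S),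
        Literature.AnabelianGeometry.SemiGraphs.IsGaloisObj H ∧ Group.ResiduallyFinite (CategoryTheory.Aut H))
    (Λv : 𝒢.graph.Vertex → Subgroup D.Tp)
    (hΛv : ∀ v, (Λv v).map (e : D.Tp →* c.G) ∈ verticialSubgroups c v)
    {E : Type*} (src tgt : E → 𝒢.graph.Vertex) (c₁ c₂ : E → D.Tp)
    (hA3 : ∀ (v w : 𝒢.graph.Vertex) (g h : D.Hat),
      MulAut.conj g • (Λv v).map D.ι ⊓ MulAut.conj h • (Λv w).map D.ι ≠ ⊥ →
        (v = w ∧ g⁻¹ * h ∈ (Λv v).map D.ι) ∨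
        ∃ (e : E) (k : D.Hat), ∃ p ∈ (Λv (src e)).map D.ι, ∃ q ∈ (Λv (tgt e)).map D.ι,
          (src e = v ∧ tgt e = w ∧ g = k * D.ι (c₁ e) * p ∧ h = k * D.ι (c₂ e) * q) ∨
          (src e = w ∧ tgt e = v ∧ h = k * D.ι (c₁ e) * p ∧ g = k * D.ι (c₂ e) * q)) :
    IsCommensurablyTerminal D.ι.range := by
  obtain ⟨v₀, hv₀c, hv₀inf⟩ := D.exists_infinite_compact_of_chart c e h𝒢 hVI Λv hΛv
  exact D.tp_isCommensurablyTerminal_of_cosetTree_of_isProfiniteCompletion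
    (D.isTempered_tp_of_chart c e) hPC (D.exists_residuallyFinite_quotient_of_chart c e hGal) Λv
    src tgt c₁ c₂ (fun Λ hΛc _ => D.conj_le_of_compactInVerticial_at c e h𝒢 hCV Λv hΛv Λ hΛc) hA3 v₀
    hv₀c hv₀inf

end TemperedGraphGroupData

end Literature.IUT.HodgeTheaters
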